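/-
Copyright: the b2b-balaban cell (near-miss cell 7), T⁴-continuum fan-out; row NE7b ROUND-2 swarm, seat
t4-ne7b-formalise-leaf-02 (gen 3) — sub-row S6g′(a)-TOTAL, file 3 (the dating display's discharge glue; leaf-05 g2's GO,
journal l.9682).  Released under the licence of the surrounding project.
-/
import Summits.QuantumFields.BalabanUV.T4Continuum.Support.HistoryZoneMassJoins
import Literature.MathematicalPhysics.QuantumFieldTheory.Balaban1983to89.T4CanonicalMenus

/-!
# Discharging the dating display from canonical chronology and renewal strictness (row S6g′(a)-TOTAL, file 3)

Summits-side support leaf of the T⁴-continuum cell (rung (B)+1 on a FINITE torus only; NOT infinite volume, NOT the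
mass gap, NOT the Clay statement; NOT a proof of the spine estimate NE7b).  Row NE7b, route «COUNT», row S6g′
«MASS-BASED SIBLING COUNT»: the TOTAL (`HistoryZoneMassTotal`, p213527) displays `HistoryZoneMassJoins.Dated st s t G`
(a renewal is never sandwiched between two mergers of the same step).  This file derives that display from facts the
sockets already carry: the CANONICAL chronology `T4CanonicalMenus.Chrono st G` (socket field `canon`: every event of a
line is dated no later than the next event) plus RENEWAL STRICTNESS `RenewStrict st G` (every event of a renewed line is
dated STRICTLY before the renewal event), and the latter from Bałaban-shaped consistency
`T4TaggedShapeBanking.ConsistentT` (renewal AT reach: `st e = h + 1 = reach`, and every event is strictly before the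
reach, `T4CanonicalMenus.consistentT_maxStep_lt_reach`).  [folklore] structural recursion; nothing is quoted from print,
nothing printed is asserted, no `[cite:]` tag, no `Prop`-valued fact of Bałaban's minted (`RenewStrict` is a decidable
predicate with parameters on OUR carrier).

WHAT.  §1 `RenewStrict st G`.  §2 **`dated_of_canon`** (`Chrono st G → RenewStrict st G → maxStep st G ≤ t → Dated st
false t G`) and **`dated_strict_of_canon`** (`… → maxStep st G < t → Dated st true t G`).  §3 **`renewStrict_of_consistentT`**
(`ConsistentT sh C K R G → RenewStrict (PEv.step ∘ sh) G`) and the packaged **`dated_of_consistentT_canon`**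
(`ConsistentT sh C K R G → Chrono (PEv.step ∘ sh) G → Dated (PEv.step ∘ sh) true (K + 1) G`) — exactly the `hD` binder of
`HistoryZoneMassTotal.sum_joins_zmass_le` ∕ `finset_sum_joins_le` with `T := K + 1`.  On the LE road (`ConsistentTLE`:
renewal no later than reach) strictness does NOT follow from the typed facts and stays the encoding's display.  §4 sanity.

HONEST SCOPE.  Bookkeeping over OUR carrier; NE7b NOT proved; spine 0∕9.  HONEST DEPENDENCY (cell): continuum YM on T⁴ ⇐
BetaPertH ∧ nine spine estimates (0/9 proved); BetaPertH ⇐ (D1) ∧ (D4) ∧ CAP+tail; G-an2-4 gates asym, D1 and NE2/3/4.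
This file changes none of it.
-/

open Literature.MathematicalPhysics.QuantumFieldTheory.Balaban1983to89
open T4PersistenceDictionary T4TaggedShapeBanking T4CanonicalMenus
open Summit.QuantumFields.BalabanUV.T4Continuum.HistoryZoneMassJoins

namespace Summit.QuantumFields.BalabanUV.T4Continuum.HistoryZoneMassDating

variable {ε : Type*}

/-! ## §1 Renewal strictness -/

section Strict

variable (st : ε → ℕ)

/-- **RENEWAL STRICTNESS**: at every renewal node, every event of the renewed line is dated STRICTLY before the renewal
event. [folklore] -/
def RenewStrict : Gen ε → Prop
  | Gen.born _ _ => True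
  | Gen.renew Y e _ => RenewStrict Y ∧ maxStep st Y < st e
  | Gen.merge X Y _ => RenewStrict X ∧ RenewStrict Y

/-- unfolding at a birth [folklore] -/
@[simp] theorem renewStrict_born (b : ε) (j : ℕ) : RenewStrict st (Gen.born b j) := trivial
/-- unfolding at a renewal [folklore] -/
theorem renewStrict_renew (Y : Gen ε) (e : ε) (h : ℕ) :
    RenewStrict st (Gen.renew Y e h) ↔ RenewStrict st Y ∧ maxStep st Y < st e := Iff.rfl
/-- unfolding at a merger [folklore] -/
theorem renewStrict_merge (X Y : Gen ε) (e : ε) :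
    RenewStrict st (Gen.merge X Y e) ↔ RenewStrict st X ∧ RenewStrict st Y := Iff.rfl

end Strict

/-! ## §2 Canonical chronology + renewal strictness ⇒ the dating display -/

section Canon

variable {st : ε → ℕ}

/-- both datings at once, by structural induction [folklore] -/
theorem dated_and_strict_of_canon :
    ∀ {G : Gen ε}, Chrono st G → RenewStrict st G →
      ∀ t : ℕ, (maxStep st G ≤ t → Dated st false t G) ∧ (maxStep st G < t → Dated st true t G)
  | Gen.born _ _, _, _, t => ⟨fun _ => dated_born _ _ _ _, fun _ => dated_born _ _ _ _⟩
  | Gen.renew Y e h, hC, hR, t => by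
      rw [chrono_renew_iff] at hC
      rw [renewStrict_renew] at hR
      have ih := (dated_and_strict_of_canon hC.1 hR.1 t).2
      have hlt : ∀ {t}, maxStep st (Gen.renew Y e h) ≤ t → maxStep st Y < t := fun ht =>
        lt_of_lt_of_le hR.2 ((le_max_right _ _).trans ht)
      exact ⟨fun ht => (dated_renew _ _ _ _ _).2 (ih (hlt ht)), fun ht => (dated_renew _ _ _ _ _).2 (ih (hlt ht.le))⟩
  | Gen.merge A B e, hC, hR, t => by
      rw [chrono_merge_iff] at hC
      rw [renewStrict_merge] at hR
      obtain ⟨hCA, hCB, -, -, hmA, hmB⟩ := hC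
      have hA := (dated_and_strict_of_canon hCA hR.1 (st e)).1 hmA
      have hB := (dated_and_strict_of_canon hCB hR.2 (st e)).1 hmB
      have hse : st e ≤ maxStep st (Gen.merge A B e) := le_max_right _ _
      exact ⟨fun ht => (dated_merge _ _ _ _ _).2 ⟨hse.trans ht, fun h => Bool.noConfusion h, hA, hB⟩,
        fun ht => (dated_merge _ _ _ _ _).2 ⟨(hse.trans ht.le), fun _ => lt_of_le_of_lt hse ht, hA, hB⟩⟩

/-- **THE LAX DATING FROM CANONICAL CHRONOLOGY AND RENEWAL STRICTNESS.** [folklore] -/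
theorem dated_of_canon {G : Gen ε} (hC : Chrono st G) (hR : RenewStrict st G) {t : ℕ} (ht : maxStep st G ≤ t) :
    Dated st false t G :=
  (dated_and_strict_of_canon hC hR t).1 ht

/-- **THE STRICT DATING** one step beyond the latest event. [folklore] -/
theorem dated_strict_of_canon {G : Gen ε} (hC : Chrono st G) (hR : RenewStrict st G) {t : ℕ} (ht : maxStep st G < t) :
    Dated st true t G :=
  (dated_and_strict_of_canon hC hR t).2 ht

end Canon

/-! ## §3 Renewal strictness from Bałaban-shaped consistency (renewal AT reach) -/

section Consistent

variable {sh : ε → PEv} {C : T4PrintedShapeBanking.Consts} {K : ℕ} {R : ℕ → ℕ}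

/-- **`ConsistentT` ⇒ RENEWAL STRICTNESS**: the renewal event is dated AT the line's reach (`st e = h + 1 = reach`) and
every event of a consistent line is strictly before its reach (`consistentT_maxStep_lt_reach`). [folklore] -/
theorem renewStrict_of_consistentT : ∀ {G : Gen ε}, ConsistentT sh C K R G → RenewStrict (PEv.step ∘ sh) G
  | Gen.born _ _, _ => trivial
  | Gen.renew Y e h, hc => by
      have hc' := hc
      simp only [ConsistentT] at hc'
      obtain ⟨hY, -, hs, hr, -⟩ := hc'
      refine (renewStrict_renew _ _ _ _).2 ⟨renewStrict_of_consistentT hY, ?_⟩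
      have hlt := consistentT_maxStep_lt_reach hY
      show maxStep (PEv.step ∘ sh) Y < (sh e).step
      omega
  | Gen.merge A B e, hc => by
      have hc' := hc
      simp only [ConsistentT] at hc'
      exact (renewStrict_merge _ _ _ _).2
        ⟨renewStrict_of_consistentT hc'.1, renewStrict_of_consistentT hc'.2.1⟩

/-- **THE TOTAL'S DATING BINDER ON THE `ConsistentT` ROAD**: a consistent, canonically chronological tagged genealogy
with cutoff `K` is strictly dated under `K + 1` (`HistoryZoneMassTotal.sum_joins_zmass_le`'s `hD` with `T := K + 1`).
[folklore] -/
theorem dated_of_consistentT_canon {G : Gen ε} (hc : ConsistentT sh C K R G) (hC : Chrono (PEv.step ∘ sh) G) :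
    Dated (PEv.step ∘ sh) true (K + 1) G :=
  dated_strict_of_canon hC (renewStrict_of_consistentT hc) (Nat.lt_succ_of_le (consistentT_maxStep_le hc))

end Consistent

/-! ## §4 Sanity (decided) -/

namespace Sanity

/-- steps read by the identity on `ℕ`-labels.  The renewal sandwich `((a b)₃ ⟲₃) ⋈₃ c` is canonically chronological
(all `≤`) but NOT renewal-strict (`3 < 3` fails); dating the renewal event at 4 and the outer merger at 4 makes it
renewal-strict, and then the lax dating under 4 holds (as file 1's sanity found by hand) -/
example :
    Chrono (fun n : ℕ => n) (Gen.merge (Gen.renew (Gen.merge (Gen.born 0 0) (Gen.born 1 1) 3) 3 5) (Gen.born 2 2) 3) ∧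
    ¬ RenewStrict (fun n : ℕ => n)
        (Gen.merge (Gen.renew (Gen.merge (Gen.born 0 0) (Gen.born 1 1) 3) 3 5) (Gen.born 2 2) 3) ∧
    RenewStrict (fun n : ℕ => n)
        (Gen.merge (Gen.renew (Gen.merge (Gen.born 0 0) (Gen.born 1 1) 3) 4 5) (Gen.born 2 2) 4) ∧
    Dated (fun n : ℕ => n) false 4
        (Gen.merge (Gen.renew (Gen.merge (Gen.born 0 0) (Gen.born 1 1) 3) 4 5) (Gen.born 2 2) 4) := by
  refine ⟨by decide, by simp [RenewStrict, maxStep], by simp [RenewStrict, maxStep], ?_⟩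
  exact dated_of_canon (by decide) (by simp [RenewStrict, maxStep]) (by simp [maxStep])

end Sanity

end Summit.QuantumFields.BalabanUV.T4Continuum.HistoryZoneMassDating
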